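import Literature.AnabelianGeometry.SemiGraphs.AmbientVocabOfReal
import Literature.AnabelianGeometry.SemiGraphs.LocalizationsProperties

/-!
# [SemiAnbd] Rmk 4.8.2 (i) ⇔ (ii) at the real vocabulary: no closed edges ⇔ a tree with at most one vertex

Mochizuki, *Semi-graphs of anabelioids*, Publ. RIMS **42** (2006), §4 Rmk 4.8.2 p.60: "One verifies
easily that [whenever `Loc(𝔾, Γ)` is defined] the following five conditions are equivalent: (i) `𝔾` has
no closed edges. (ii) `𝔾` is a tree [cf. §1] with at most one vertex. (iii) … (iv) … (v) …" (kurims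
`paper:url-f33ace170ff4`, read on p.60).
[cite: MochizukiSemiAnbd2006, Rmk 4.8.2, p. 60]

PROOF-ONLY, the COMBINATORIAL equivalence (i) ⇔ (ii) of the typed statement
`Loc.DegenerateCasesStatement` (`LocalizationsProperties.lean`; its conjuncts (ii) ⇔ (iii) ⇔ (iv) ⇔ (v)
concern the category `Loc(𝔾, Γ)` and are not touched here), at `𝓥 := SemiAnbdVocab.ofReal R`, under
the hypotheses `LocHypotheses` (p.51: `𝔾` finite and connected, …) that alone make the statement
meaningful: `Loc.degenerateCases_i_iff_ii_ofReal`.  Route: a connected object of `SgA` all of whose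
edges are open has at most one vertex (an open edge abuts to at most one vertex, so the component of a
vertex under the incidence relation contains no other vertex), and the container's Euler-characteristic
rendering of "tree" (`#V = #closed edges + 1` or no vertex) then reduces to counting.  No definitions.
-/

namespace Literature.AnabelianGeometry.SemiGraphs

open CategoryTheory

universe v₁ u₁ u

namespace SemiAnbdVocab

open SgAQuot SgAQuot.SgA

variable (R : SgA.BridgeResidual.{v₁, u₁, u}) {G : SgA.{v₁, u₁, u}}

/-- Two distinct branches of one edge exhaust its branches (every edge has exactly two, §1 (2)).
[cite: MochizukiSemiAnbd2006, §1, p. 11] -/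
theorem _root_.Literature.AnabelianGeometry.SemiGraphs.SemiGraph.branchesOf_eq_or_eq
    (Γ₀ : SemiGraph.{u}) {e : Γ₀.Edge} (b₁ b₂ : Γ₀.branchesOf e) (hne : b₁ ≠ b₂)
    (b : Γ₀.branchesOf e) : b = b₁ ∨ b = b₂ := by
  obtain ⟨c₁, c₂, hcne, h₁, h₂, hall⟩ := Γ₀.two_branches e
  have hne' : b₁.1 ≠ b₂.1 := fun h => hne (Subtype.ext h)
  rcases hall b.1 b.2 with k | k <;> rcases hall b₁.1 b₁.2 with k₁ | k₁ <;>
    rcases hall b₂.1 b₂.2 with k₂ | k₂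
  · exact absurd (k₁.trans k₂.symm) hne'
  · exact Or.inl (Subtype.ext (k.trans k₁.symm))
  · exact Or.inr (Subtype.ext (k.trans k₂.symm))
  · exact absurd (k₁.trans k₂.symm) hne'
  · exact absurd (k₁.trans k₂.symm) hne'
  · exact Or.inr (Subtype.ext (k.trans k₂.symm))
  · exact Or.inl (Subtype.ext (k.trans k₁.symm))
  · exact absurd (k₁.trans k₂.symm) hne'

/-- An edge that is NOT closed abuts (through its branches) to at most one vertex.
[cite: MochizukiSemiAnbd2006, §1, p. 12] -/
theorem eq_of_abuts_of_not_isClosedEdge {e : G.toSgA.graph.Edge}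
    (he : ¬ (SemiAnbdVocab.ofReal R).IsClosedEdge e) {b b' : G.toSgA.graph.branchesOf e}
    {v w : G.toSgA.graph.Vertex} (hb : G.toSgA.graph.abuts b.1 = some v)
    (hb' : G.toSgA.graph.abuts b'.1 = some w) : v = w := by
  by_cases hbb : b = b'
  · subst hbb; exact Option.some_injective _ (hb.symm.trans hb')
  · exfalso
    apply he
    intro c
    rcases G.toSgA.graph.branchesOf_eq_or_eq b b' hbb c with rfl | rfl
    · change (G.toSgA.graph.abuts c.1).isSome = true
      rw [hb]; rfl
    · change (G.toSgA.graph.abuts c.1).isSome = true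
      rw [hb']; rfl

/-- **A connected object all of whose edges are open has at most one vertex** (the incidence class
of a vertex `v₀` consists of `v₀` and the edges abutting to `v₀` only).
[cite: MochizukiSemiAnbd2006, §1, p. 12] -/
theorem subsingleton_vertex_of_forall_not_isClosedEdge
    (hconn : (SemiAnbdVocab.ofReal R).IsConnected G)
    (hopen : ∀ e : G.toSgA.graph.Edge, ¬ (SemiAnbdVocab.ofReal R).IsClosedEdge e) :
    Subsingleton G.toSgA.graph.Vertex := by
  refine ⟨fun v₀ w => ?_⟩
  -- the incidence class of `v₀`
  let S : G.toSgA.graph.Vertex ⊕ G.toSgA.graph.Edge → Prop := fun x =>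
    match x with
    | .inl v => v = v₀
    | .inr e => ∃ b : G.toSgA.graph.branchesOf e, G.toSgA.graph.abuts b.1 = some v₀
  have step : ∀ x y, (SemiAnbdVocab.ofReal R).Incident G x y → (S x ↔ S y) := by
    rintro (v | e) (v' | e') h
    · exact absurd h id
    · -- vertex – edge
      obtain ⟨b, hb⟩ := h
      change G.toSgA.graph.abuts b.1 = some v at hb
      constructor
      · rintro (rfl : v = v₀); exact ⟨b, hb⟩
      · rintro ⟨b', hb'⟩
        exact eq_of_abuts_of_not_isClosedEdge R (hopen e') hb hb'
    · -- edge – vertex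
      obtain ⟨b, hb⟩ := h
      change G.toSgA.graph.abuts b.1 = some v' at hb
      constructor
      · rintro ⟨b', hb'⟩
        exact eq_of_abuts_of_not_isClosedEdge R (hopen e) hb hb'
      · rintro (rfl : v' = v₀); exact ⟨b, hb⟩
    · exact absurd h id
  have key : ∀ x y, Relation.EqvGen ((SemiAnbdVocab.ofReal R).Incident G) x y → (S x ↔ S y) := by
    intro x y h
    induction h with
    | rel x y h => exact step x y h
    | refl => exact Iff.rfl
    | symm _ _ _ ih => exact ih.symm
    | trans _ _ _ _ _ ih₁ ih₂ => exact ih₁.trans ih₂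
  have := (key (Sum.inl v₀) (Sum.inl w) (hconn.2 _ _)).mp rfl
  exact this.symm

end SemiAnbdVocab

namespace Loc

open SgAQuot SgAQuot.SgA SemiAnbdVocab

variable (R : SgA.BridgeResidual.{v₁, u₁, u})

/-- **Rmk 4.8.2 (i) ⇔ (ii), PROVED at the real vocabulary**: when `Loc(𝔾, Γ)` is defined (`𝔾`
finite and connected), `𝔾` has no closed edges iff `𝔾` is a tree with at most one vertex — the first
conjunct of `Loc.DegenerateCasesStatement (SemiAnbdVocab.ofReal R) G Γ`.
[cite: MochizukiSemiAnbd2006, Rmk 4.8.2, p. 60] -/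
theorem degenerateCases_i_iff_ii_ofReal (G : SgA.{v₁, u₁, u}) (Γ : Subgroup (Aut G))
    (hL : Literature.AnabelianGeometry.SemiGraphs.Loc.LocHypotheses (SemiAnbdVocab.ofReal R) G Γ) :
    (∀ e : (SemiAnbdVocab.ofReal R).Edge G, ¬ (SemiAnbdVocab.ofReal R).IsClosedEdge e) ↔
      ((SemiAnbdVocab.ofReal R).IsFiniteTree G ∧ Nat.card ((SemiAnbdVocab.ofReal R).Vert G) ≤ 1) := by
  have hfin : (SemiAnbdVocab.ofReal R).IsFinite G := hL.isFinite
  have hconn : (SemiAnbdVocab.ofReal R).IsConnected G := hL.isConnected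
  haveI : Finite G.toSgA.graph.Vertex := hfin.1
  haveI : Finite G.toSgA.graph.Edge := hfin.2
  change (∀ e : G.toSgA.graph.Edge, ¬ (SemiAnbdVocab.ofReal R).IsClosedEdge e) ↔
    (((SemiAnbdVocab.ofReal R).IsFinite G ∧ (SemiAnbdVocab.ofReal R).IsConnected G ∧
        (Nat.card G.toSgA.graph.Vertex =
            Nat.card {e : G.toSgA.graph.Edge // (SemiAnbdVocab.ofReal R).IsClosedEdge e} + 1 ∨
          IsEmpty G.toSgA.graph.Vertex)) ∧
      Nat.card G.toSgA.graph.Vertex ≤ 1)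
  constructor
  · intro hopen
    have hC : Nat.card {e : G.toSgA.graph.Edge // (SemiAnbdVocab.ofReal R).IsClosedEdge e} = 0 :=
      Nat.card_eq_zero.mpr (Or.inl ⟨fun e => hopen e.1 e.2⟩)
    haveI := subsingleton_vertex_of_forall_not_isClosedEdge R hconn hopen
    rcases isEmpty_or_nonempty G.toSgA.graph.Vertex with hV | ⟨⟨v₀⟩⟩
    · have h0 : Nat.card G.toSgA.graph.Vertex = 0 := Nat.card_eq_zero.mpr (Or.inl hV)
      exact ⟨⟨hfin, hconn, Or.inr hV⟩, by omega⟩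
    · have h1 : Nat.card G.toSgA.graph.Vertex = 1 := Nat.card_of_subsingleton v₀
      exact ⟨⟨hfin, hconn, Or.inl (by omega)⟩, by omega⟩
  · rintro ⟨⟨-, -, h⟩, hle⟩ e he
    rcases h with h | hV
    · have hC : Nat.card {e : G.toSgA.graph.Edge // (SemiAnbdVocab.ofReal R).IsClosedEdge e} = 0 := by
        omega
      rw [Nat.card_eq_zero] at hC
      rcases hC with hC | hC
      · exact hC.false ⟨e, he⟩
      · exact not_finite {e : G.toSgA.graph.Edge // (SemiAnbdVocab.ofReal R).IsClosedEdge e}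
    · -- no vertex: no branch abuts, so no edge is closed (an edge has a branch)
      obtain ⟨b₁, -, -, h₁, -, -⟩ := G.toSgA.graph.two_branches e
      obtain ⟨v, _⟩ := Option.isSome_iff_exists.mp (he ⟨b₁, h₁⟩)
      exact hV.elim v

end Loc

end Literature.AnabelianGeometry.SemiGraphs
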